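import Mathlib
import HarnessLib
import Literature.NumberTheory.Transcendental.RoySmallValueSupProd
import Summits.Parity.BatemanHorn.Theses.AlmostPrimeZeros

/-!
# A necessary condition for zero repulsion: the degree of the almost-prime polynomial
# (crux `AlmostPrimeZeros.SystemZeroRepulsion`, stmt-Parity-11291; line `smooth-rough-lattice-acquisition`, lead's note)

For ANY exponent sequence `s : ℕ → ℕ` let `P_x = Σ_{0≤n≤x} X^{s(n)} ∈ ℂ[X]` (degree `d_x = max_{n≤x} s(n)`, coefficients the
counts `#{n : s(n) = j}`, `P_x(1) = x+1`).  Since its leading coefficient is a positive integer, its Mahler measure satisfies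
`∏_ρ max(1, ‖ρ‖) ≤ M(P_x) ≤ sup_{‖z‖=1} ‖P_x(z)‖ ≤ x+1` (Mathlib `Polynomial.mahlerMeasure`, tree
`Roy2013.mahlerMeasure_le_of_sphere`), so for every `R > 1` at most `log(x+1)/log R` roots have modulus `≥ R`, and the remaining
`≥ d_x − log(x+1)/log R` roots each contribute at least `(1+R)⁻²` to the crux's functional `T(x) = Σ_ρ ‖1−ρ‖⁻²`.  Hence
`(d_x − log(x+1)/log R)·(1+R)⁻² ≤ T(x)` for all `R > 1`: a bounded `T` (the crux) forces
`max_{n≤x} s_f(n) ≤ C(1+R)² + log(x+1)/log R`, i.e. `≤ (2+o(1))·log x/log log x` with `R = (log x)^{1/2−o(1)}` — for systems with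
`Σ deg f_i ≥ 3` an open "no ultra-champion values" statement (observation of the S1 stub-worker, work/stubs/FarMoment.status.md §2).
References: K. Mahler (1960); E. Landau (1905) `M(P) ≤ ‖P‖₂`; Mathlib `Mathlib/Analysis/Polynomial/MahlerMeasure.lean`.
-/

noncomputable section

open Finset Polynomial

namespace Summit.Parity.BatemanHorn.Cruxes.SystemZeroRepulsion.SmoothRoughLatticeAcquisition

/-- `R^{#m} ≤ ∏ m` for a multiset of reals all `≥ R ≥ 0`. -/
private theorem pow_card_le_prod_real {m : Multiset ℝ} {R : ℝ} (hR : 0 ≤ R) (h : ∀ y ∈ m, R ≤ y) :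
    R ^ m.card ≤ m.prod := by
  induction m using Multiset.induction_on with
  | empty => simp
  | cons a m ih =>
    rw [Multiset.card_cons, Multiset.prod_cons, pow_succ, mul_comm]
    have ha : R ≤ a := h a (Multiset.mem_cons_self a m)
    have hm : ∀ y ∈ m, R ≤ y := fun y hy => h y (Multiset.mem_cons_of_mem hy)
    have ih' := ih hm
    exact mul_le_mul ha ih' (pow_nonneg hR _) (hR.trans ha)

/-- For `P ∈ ℂ[X]` with `‖lead P‖ ≥ 1` and `‖P(z)‖ ≤ B` on the unit circle, at most `log B / log R` roots (with multiplicity)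
have modulus `≥ R` (`R > 1`): `R^{#} ≤ ∏_ρ max(1,‖ρ‖) ≤ M(P) ≤ B`. -/
private theorem card_roots_norm_ge_le {P : ℂ[X]} (hlc : 1 ≤ ‖P.leadingCoeff‖) {B : ℝ} (hB : 1 ≤ B)
    (hcirc : ∀ z ∈ Metric.sphere (0 : ℂ) 1, ‖P.eval z‖ ≤ B) {R : ℝ} (hR : 1 < R) :
    ((P.roots.filter fun ρ : ℂ => R ≤ ‖ρ‖).card : ℝ) ≤ Real.log B / Real.log R := by
  have hR0 : 0 < R := one_pos.trans hR
  have hlogR : 0 < Real.log R := Real.log_pos hR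
  set S₁ := P.roots.filter fun ρ : ℂ => R ≤ ‖ρ‖ with hS₁
  set S₂ := P.roots.filter fun ρ : ℂ => ¬ R ≤ ‖ρ‖ with hS₂
  have hsplit : P.roots = S₁ + S₂ := (Multiset.filter_add_not _ _).symm
  -- `R^{#S₁} ≤ ∏ max(1, ‖ρ‖)`
  have hprod : R ^ S₁.card ≤ (P.roots.map fun a : ℂ => max 1 ‖a‖).prod := by
    rw [hsplit, Multiset.map_add, Multiset.prod_add]
    have h1 : R ^ S₁.card ≤ (S₁.map fun a : ℂ => max 1 ‖a‖).prod := by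
      have h := pow_card_le_prod_real (m := S₁.map fun a : ℂ => max 1 ‖a‖) hR0.le (fun y hy => by
        obtain ⟨ρ, hρ, rfl⟩ := Multiset.mem_map.1 hy
        exact le_max_of_le_right (Multiset.mem_filter.1 hρ).2)
      rwa [Multiset.card_map] at h
    have h2 : 1 ≤ (S₂.map fun a : ℂ => max 1 ‖a‖).prod := by
      have h := pow_card_le_prod_real (m := S₂.map fun a : ℂ => max 1 ‖a‖) zero_le_one (fun y hy => by
        obtain ⟨ρ, _, rfl⟩ := Multiset.mem_map.1 hy
        exact le_max_left _ _)
      rwa [one_pow] at h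
    have h0 : 0 ≤ (S₁.map fun a : ℂ => max 1 ‖a‖).prod :=
      Multiset.prod_nonneg fun y hy => by
        obtain ⟨ρ, _, rfl⟩ := Multiset.mem_map.1 hy
        positivity
    calc R ^ S₁.card ≤ (S₁.map fun a : ℂ => max 1 ‖a‖).prod * 1 := by rw [mul_one]; exact h1
      _ ≤ (S₁.map fun a : ℂ => max 1 ‖a‖).prod * (S₂.map fun a : ℂ => max 1 ‖a‖).prod :=
          mul_le_mul_of_nonneg_left h2 h0
  have hM : (P.roots.map fun a : ℂ => max 1 ‖a‖).prod ≤ B :=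
    (prod_max_one_norm_roots_le_mahlerMeasure_of_one_le_leadingCoeff hlc).trans
      (Literature.NumberTheory.Transcendental.Roy2013.mahlerMeasure_le_of_sphere P (by linarith) hcirc)
  have hpow : R ^ S₁.card ≤ B := hprod.trans hM
  have hlog : (S₁.card : ℝ) * Real.log R ≤ Real.log B := by
    have h := Real.log_le_log (pow_pos hR0 _) hpow
    rwa [Real.log_pow] at h
  rwa [le_div_iff₀ hlogR]

/-- **Zero repulsion bounds the degree (analytic form).**  If `P ≠ 0`, `P(1) ≠ 0`, `‖lead P‖ ≥ 1` and `‖P(z)‖ ≤ B` on `‖z‖ = 1`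
(`B ≥ 1`), then for every `R > 1`: `(#roots(P) − log B/log R)·((1+R)²)⁻¹ ≤ Σ_ρ ‖1 − ρ‖⁻²`. -/
private theorem repulsion_ge_of_circle {P : ℂ[X]} (hP : P ≠ 0) (h1 : P.eval 1 ≠ 0) (hlc : 1 ≤ ‖P.leadingCoeff‖)
    {B : ℝ} (hB : 1 ≤ B) (hcirc : ∀ z ∈ Metric.sphere (0 : ℂ) 1, ‖P.eval z‖ ≤ B) {R : ℝ} (hR : 1 < R) :
    ((P.roots.card : ℝ) - Real.log B / Real.log R) * ((1 + R) ^ 2)⁻¹ ≤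
      (P.roots.map fun ρ : ℂ => (‖(1 : ℂ) - ρ‖ ^ 2)⁻¹).sum := by
  have hR0 : 0 < R := one_pos.trans hR
  set S₁ := P.roots.filter fun ρ : ℂ => R ≤ ‖ρ‖ with hS₁
  set S₂ := P.roots.filter fun ρ : ℂ => ¬ R ≤ ‖ρ‖ with hS₂
  have hsplit : P.roots = S₁ + S₂ := (Multiset.filter_add_not _ _).symm
  have hcard : (P.roots.card : ℝ) = S₁.card + S₂.card := by
    rw [hsplit, Multiset.card_add]; push_cast; rfl
  have hS₁le := card_roots_norm_ge_le hlc hB hcirc hR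
  -- each near root contributes at least `(1+R)⁻²`
  have hterm : ∀ ρ ∈ S₂, ((1 + R) ^ 2)⁻¹ ≤ (‖(1 : ℂ) - ρ‖ ^ 2)⁻¹ := by
    intro ρ hρ
    obtain ⟨hρr, hρR⟩ := Multiset.mem_filter.1 hρ
    have hne : (1 : ℂ) - ρ ≠ 0 := by
      intro h
      have : ρ = 1 := (sub_eq_zero.1 h).symm
      rw [this] at hρr
      exact h1 ((mem_roots hP).1 hρr)
    have hpos : 0 < ‖(1 : ℂ) - ρ‖ := norm_pos_iff.2 hne
    have hle : ‖(1 : ℂ) - ρ‖ ≤ 1 + R := by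
      calc ‖(1 : ℂ) - ρ‖ ≤ ‖(1 : ℂ)‖ + ‖ρ‖ := norm_sub_le _ _
        _ ≤ 1 + R := by rw [norm_one]; linarith [not_le.1 hρR]
    exact inv_anti₀ (by positivity) (pow_le_pow_left₀ hpos.le hle 2)
  have hsum₂ : (S₂.card : ℝ) * ((1 + R) ^ 2)⁻¹ ≤ (S₂.map fun ρ : ℂ => (‖(1 : ℂ) - ρ‖ ^ 2)⁻¹).sum := by
    have h := Multiset.card_nsmul_le_sum (s := S₂.map fun ρ : ℂ => (‖(1 : ℂ) - ρ‖ ^ 2)⁻¹) (a := ((1 + R) ^ 2)⁻¹)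
      (fun y hy => by
        obtain ⟨ρ, hρ, rfl⟩ := Multiset.mem_map.1 hy
        exact hterm ρ hρ)
    rwa [Multiset.card_map, nsmul_eq_mul] at h
  have hsum₁ : 0 ≤ (S₁.map fun ρ : ℂ => (‖(1 : ℂ) - ρ‖ ^ 2)⁻¹).sum :=
    Multiset.sum_nonneg fun y hy => by
      obtain ⟨ρ, _, rfl⟩ := Multiset.mem_map.1 hy
      positivity
  have htot : (P.roots.map fun ρ : ℂ => (‖(1 : ℂ) - ρ‖ ^ 2)⁻¹).sum =
      (S₁.map fun ρ : ℂ => (‖(1 : ℂ) - ρ‖ ^ 2)⁻¹).sum + (S₂.map fun ρ : ℂ => (‖(1 : ℂ) - ρ‖ ^ 2)⁻¹).sum := by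
    rw [hsplit, Multiset.map_add, Multiset.sum_add]
  rw [htot, hcard]
  have hw : 0 ≤ ((1 + R) ^ 2)⁻¹ := by positivity
  nlinarith [mul_le_mul_of_nonneg_right hS₁le hw]

/-- **Stub `stub_repulsionLowerBound` — zero repulsion forces a degree bound.**  For every exponent sequence
`s : ℕ → ℕ`, every `x : ℕ` and every real `R > 1`, the crux's functional of `P_x = Σ_{n ≤ x} X^{s(n)}` satisfies
`(max_{n≤x} s(n) − log(x+1)/log R)·((1+R)²)⁻¹ ≤ Σ_ρ ‖1−ρ‖⁻²` (roots of `P_x` with multiplicity).  In particular, if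
`T_f(x) ≤ C` for all `x` (i.e. `SystemZeroRepulsion` for the system `f`, with `s = s_f`), then
`max_{n≤x} s_f(n) ≤ C(1+R)² + log(x+1)/log R` for every `R > 1` and every `x`. -/
theorem stub_repulsionLowerBound :
    ∀ (s : ℕ → ℕ) (x : ℕ) (R : ℝ), 1 < R →
      ((((Finset.range (x + 1)).sup s : ℕ) : ℝ) - Real.log ((x : ℝ) + 1) / Real.log R) * ((1 + R) ^ 2)⁻¹ ≤
        (((∑ n ∈ Finset.range (x + 1), (Polynomial.X : Polynomial ℂ) ^ (s n)).roots.map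
          (fun ρ : ℂ => (‖(1 : ℂ) - ρ‖ ^ 2)⁻¹)).sum) := by
  intro s x R hR
  classical
  set P : ℂ[X] := ∑ n ∈ Finset.range (x + 1), (X : ℂ[X]) ^ (s n) with hPdef
  set d : ℕ := (Finset.range (x + 1)).sup s with hd
  -- evaluation and coefficients
  have heval : ∀ z : ℂ, P.eval z = ∑ n ∈ Finset.range (x + 1), z ^ (s n) := fun z => by
    simp [hPdef, Polynomial.eval_finsetSum]
  have hP1 : P.eval 1 = (x : ℂ) + 1 := by rw [heval]; simp
  have hP1ne : P.eval 1 ≠ 0 := by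
    rw [hP1]; exact_mod_cast Nat.succ_ne_zero x
  have hP : P ≠ 0 := fun h => hP1ne (by rw [h, eval_zero])
  have hcoeff : ∀ j : ℕ, P.coeff j = (((Finset.range (x + 1)).filter fun n => s n = j).card : ℂ) := by
    intro j
    rw [hPdef, finsetSum_coeff]
    simp only [coeff_X_pow]
    rw [Finset.sum_ite, Finset.sum_const_zero, add_zero, Finset.sum_const, nsmul_eq_mul, mul_one]
    congr 2
    ext n; simp [eq_comm]
  -- the degree is `d` and the leading coefficient is a positive integer
  obtain ⟨n₀, hn₀, hdn₀⟩ := Finset.exists_mem_eq_sup (Finset.range (x + 1)) ⟨0, by simp⟩ s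
  have hdeg_le : P.natDegree ≤ d :=
    Polynomial.natDegree_sum_le_of_forall_le _ _ fun n hn => by
      rw [Polynomial.natDegree_X_pow]; exact Finset.le_sup hn
  have hcoeffd : P.coeff d ≠ 0 := by
    rw [hcoeff d, Nat.cast_ne_zero, ← pos_iff_ne_zero, Finset.card_pos]
    exact ⟨n₀, Finset.mem_filter.2 ⟨hn₀, hdn₀.symm⟩⟩
  have hdeg : P.natDegree = d := le_antisymm hdeg_le (le_natDegree_of_ne_zero hcoeffd)
  have hlc : 1 ≤ ‖P.leadingCoeff‖ := by
    rw [leadingCoeff, hdeg, hcoeff d, Complex.norm_natCast]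
    have : 1 ≤ ((Finset.range (x + 1)).filter fun n => s n = d).card :=
      Finset.card_pos.2 ⟨n₀, Finset.mem_filter.2 ⟨hn₀, hdn₀.symm⟩⟩
    exact_mod_cast this
  -- the unit-circle bound `‖P(z)‖ ≤ x + 1`
  have hcirc : ∀ z ∈ Metric.sphere (0 : ℂ) 1, ‖P.eval z‖ ≤ (x : ℝ) + 1 := by
    intro z hz
    rw [mem_sphere_zero_iff_norm] at hz
    rw [heval]
    calc ‖∑ n ∈ Finset.range (x + 1), z ^ (s n)‖ ≤ ∑ n ∈ Finset.range (x + 1), ‖z ^ (s n)‖ := norm_sum_le _ _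
      _ = (x : ℝ) + 1 := by simp [norm_pow, hz]
  have hx1 : (1 : ℝ) ≤ (x : ℝ) + 1 := by linarith [(Nat.cast_nonneg x : (0 : ℝ) ≤ x)]
  -- root count = degree
  have hcard : (P.roots.card : ℝ) = d := by
    rw [IsAlgClosed.card_roots_eq_natDegree, hdeg]
  have h := repulsion_ge_of_circle hP hP1ne hlc hx1 hcirc hR
  rwa [hcard] at h

/-- **Corollary: `SystemZeroRepulsion` bounds the champions of every Bateman–Horn system.**  If the crux holds, then for
every Bateman–Horn system `f` there is `C` with `(max_{n≤x} s_f(n) − log(x+1)/log R)·((1+R)²)⁻¹ ≤ C` for all `x ≥ 2` and all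
`R > 1` (`s_f` the capped statistic of the route).  With `R = (log x)^{ν}`, `ν < 1/2`, this reads
`max_{n≤x} s_f(n) ≤ log(x+1)/(ν log log x) + C(1+(log x)^ν)² = (1/ν + o(1))·log x/log log x`. -/
theorem degreeBound_of_systemZeroRepulsion
    (h : Summit.Parity.BatemanHorn.Theses.AlmostPrimeZeros.SystemZeroRepulsion) :
    ∀ (k : ℕ) (f : Fin k → Polynomial ℤ), Literature.NumberTheory.Sieve.IsBatemanHornSystem f →
      ∃ C : ℝ, ∀ x : ℕ, 2 ≤ x → ∀ R : ℝ, 1 < R →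
        ((((Finset.range (x + 1)).sup fun n : ℕ =>
            ∑ i, (((f i).eval (n : ℤ)).toNat.factorization.sum fun _ v => min v 2) : ℕ) : ℝ) -
            Real.log ((x : ℝ) + 1) / Real.log R) * ((1 + R) ^ 2)⁻¹ ≤ C := by
  intro k f hf
  obtain ⟨C, hC⟩ := h k f hf
  refine ⟨C, fun x hx R hR => ?_⟩
  have key := stub_repulsionLowerBound
    (fun n : ℕ => ∑ i, (((f i).eval (n : ℤ)).toNat.factorization.sum (fun _ v => min v 2))) x R hR
  exact key.trans (hC x hx)

end Summit.Parity.BatemanHorn.Cruxes.SystemZeroRepulsion.SmoothRoughLatticeAcquisition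

end
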